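import Summits.CriticalPhenomena.PercolationContinuityZ3.Theses.PercNearOneGluing
import Literature.Probability.Percolation.PercolationProofs
import Literature.Probability.Percolation.ConditionalPositiveAssociationProofs
import Literature.Probability.Percolation.TwoClusterConditionalAssociationProofs
import Summits.CriticalPhenomena.PercolationContinuityZ3.Theorems.PercNearOneGluingAdditiveGluingGoodTwoRelays

/-! TTRL-lite variant V215 of stmt-CriticalPhenomena-4576

(`stub_goodStep`, move `small_case+small_case`: `A.card ≤ 3` and `n ≤ 4`).  With at most three
relays the inductive step needs no induction hypothesis: it is exactly the two-relay goodness
theorem `stub_goodStepTwoRelays_k41` (which covers every `A` with `A.card ≤ 3`).  The bound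
`n ≤ 4`, the low neighbour `y` and the induction hypothesis are not used. -/

namespace Summit.CriticalPhenomena.PercolationContinuityZ3.Theorems

open MeasureTheory Literature.Probability.LatticeModels Literature.Probability.Percolation
open scoped Classical BigOperators

/-- TTRL-lite variant V215 of `stub_goodStep` (stmt-CriticalPhenomena-4576): the additive-gluing
good step on at most four vertices with at most three relays.  Since `A.card ≤ 3`, the
conclusion is the two-relay goodness inequality `stub_goodStepTwoRelays_k41` verbatim; the
hypotheses `n ≤ 4`, the existence of a low neighbour `y ∉ A` of `o`, and the induction
hypothesis on the number of active vertices are discarded. [this project] -/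
theorem stub_goodStep_var215 : ∀ (n : ℕ) (w : Sym2 (Fin n) → unitInterval) (A : Finset (Fin n)) (o b : Fin n), n ≤ 4 → A.card ≤ 3 → b ∈ A → o ∉ A → (∃ y : Fin n, y ∉ A ∧ y ≠ o ∧ (w s(o, y) : ℝ) ≠ 0) → (∀ w' : Sym2 (Fin n) → unitInterval, (Finset.univ.filter (fun v : Fin n => ∃ u : Fin n, 0 < (w' s(u, v) : ℝ))).card < (Finset.univ.filter (fun v : Fin n => ∃ u : Fin n, 0 < (w s(u, v) : ℝ))).card → ∀ (A' : Finset (Fin n)) (o' b' : Fin n), b' ∈ A' → o' ∉ A' → ∀ (t : ℝ) (sel : Finset (Fin n) → Fin n), (∀ W, sel W ∈ A') → (∀ a ∈ A', 1 - t ≤ (prodBernoulli w').real (openConn a b')) → (prodBernoulli w').real ((⋃ a ∈ A', openConn o' a) ∩ (openConn o' b')ᶜ) + ∑ W ∈ (Finset.univ : Finset (Finset (Fin n))).filter (fun W => o' ∈ W ∧ Disjoint W A'), (prodBernoulli w').real {ω : BondConfig (Fin n) | openCluster ω o' = (W : Set (Fin n))} * (prodBernoulli w').real (openConnIn ((W :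 Set (Fin n))ᶜ) (sel W) b')ᶜ ≤ t) → ∀ (t : ℝ) (sel : Finset (Fin n) → Fin n), (∀ W, sel W ∈ A) → (∀ a ∈ A, 1 - t ≤ (prodBernoulli w).real (openConn a b)) → (prodBernoulli w).real ((⋃ a ∈ A, openConn o a) ∩ (openConn o b)ᶜ) + ∑ W ∈ (Finset.univ : Finset (Finset (Fin n))).filter (fun W => o ∈ W ∧ Disjoint W A), (prodBernoulli w).real {ω : BondConfig (Fin n) | openCluster ω o = (W : Set (Fin n))} * (prodBernoulli w).real (openConnIn ((W : Set (Fin n))ᶜ) (sel W) b)ᶜ ≤ t := by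
  intro n w A o b _hn hA hbA hoA _hy _ih t sel hsel hrel
  exact stub_goodStepTwoRelays_k41 n w A o b hbA hoA hA t sel hsel hrel

end Summit.CriticalPhenomena.PercolationContinuityZ3.Theorems
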